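import Summits.ResolutionOfSingularities.ResolutionOfSingularities.Theorems.WeightedInvariantSingularLocusHomogeneous
import Summits.ResolutionOfSingularities.ResolutionOfSingularities.Theorems.WeightedInvariantRegularSubschemeCentre
import Summits.ResolutionOfSingularities.ResolutionOfSingularities.Theorems.WeightedInvariantHypersurfaceAdmissibleSequences
import Literature.AlgebraicGeometry.Resolution.RegularLocusDense
import HarnessLib

/-!
# Every singular pair admits an ADMISSIBLE centre with non-empty support

Route `ResolutionOfSingularities/WeightedInvariant`, door crux `HypersurfaceCentreConstruction`
(stmt-ResolutionOfSingularities-19897), helper #4 (summit-side, OURS). The ∃-form of the door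
(`HypersurfacePair.AdmissiblyResolvable`, `nonempty_hypersurfaceTerminatingCentreDatum_of_finiteSequences`) asks
for FINITE SEQUENCES of admissible centres (`IsAdmissibleCentre f X R`: `(iii-a)` regular weighted centre,
`(iii-b′)` support inside `singImage X`, `(hom)` pieces homogeneous on every torus chart of the pair) ending at a
regular pair. This file certifies in the kernel that the FIRST step is always possible in a non-trivial way —
the designer memo's §3 «the admissible-centre set is non-empty at every guarded pair» with ALL THREE clauses:

* `exists_isAdmissibleCentre_support_eq_of_good` — Noetherian induction on the closed subsets `Z ⊆ singImage X`
  that are non-empty and «torus-intrinsic» (`𝓘(Z)(W)` homogeneous on every graded affine chart `W` with `X(W)`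
  homogeneous): either the reduced `V(𝓘(Z))` is regular — then the powers of `𝓘(Z)` are an admissible centre
  with support `Z` (`isRegularWeightedCentre_powers_of_isRegular`) — or its non-regular locus `Z' ⊊ Z`
  (`Scheme.dense_regularLocus`: the regular locus of a reduced scheme is dense) is again non-empty, closed
  (`isClosed_singSet`) and torus-intrinsic (`vanishingIdeal_singSet_isHomogeneous`), and we descend;
* `exists_isAdmissibleCentre` — for `f : Y → Spec k` smooth quasi-compact and `X` an ideal sheaf with
  NON-regular `V(X)`: `∃ R, IsAdmissibleCentre f X R ∧ R.support.Nonempty` (start the induction at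
  `Z₀ = singImage X`, torus-intrinsic by `vanishingIdeal_singSet_isHomogeneous`). The centre found is the Rees
  algebra of powers of the reduced ideal of the LAST NON-EMPTY ITERATED SINGULAR STRATUM of `V(X)`.

What this is NOT: no claim that blowing up these centres terminates (`(term)` / `AdmissiblyResolvable`) — that is
the content of the door. AI-written; weaker than expert review.
References: J. Włodarczyk, arXiv:2203.03090, 2.1.10 and Thm. 1.1.4 (6) [Wlodarczyk2022].
-/

noncomputable section

open CategoryTheory AlgebraicGeometry TopologicalSpace IsLocalRing
open Literature.AlgebraicGeometry.Resolution

set_option linter.dupNamespace false -- mandated namespace of this single-conjunct summit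

namespace Summit.ResolutionOfSingularities.ResolutionOfSingularities.Theorems

/-! ## Powers of homogeneous ideals -/

/-- Powers of a homogeneous ideal are homogeneous. [folklore] -/
theorem isHomogeneous_pow {ι A σ : Type*} [DecidableEq ι] [AddMonoid ι] [CommSemiring A]
    [SetLike σ A] [AddSubmonoidClass σ A] {𝒜 : ι → σ} [GradedRing 𝒜] {I : Ideal A}
    (hI : I.IsHomogeneous 𝒜) (n : ℕ) : (I ^ n).IsHomogeneous 𝒜 := by
  induction n with
  | zero => rw [pow_zero, Ideal.one_eq_top]; exact Ideal.IsHomogeneous.top 𝒜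
  | succ n ih => rw [pow_succ]; exact Ideal.IsHomogeneous.mul ih hI

/-! ## The induction -/

section Induction

variable {k : Type} [Field k] {Y : Scheme.{0}} (f : Y ⟶ Spec (.of k)) (X : Y.IdealSheafData)

/-- **Admissible centres with prescribed support, by Noetherian induction.** Let `f : Y → Spec k` be smooth with
`Y` a Noetherian space and `X` an ideal sheaf on `Y`. Every closed `Z ⊆ Y` which is non-empty, contained in
`singImage X`, and TORUS-INTRINSIC — `𝓘(Z)(W)` is homogeneous for every affine open `W` and every `ℤʲ`-grading of
`Γ(Y, W)` making `X(W)` homogeneous — contains the (non-empty) support of an admissible centre for `(f, X)`: if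
the reduced `V(𝓘(Z))` is regular, the powers of `𝓘(Z)` (`isRegularWeightedCentre_powers_of_isRegular`; `(hom)` by
`isHomogeneous_pow`); otherwise recurse into its non-regular locus, a strictly smaller closed set with the
same three properties (`Scheme.dense_regularLocus`, `isClosed_singSet`, `vanishingIdeal_singSet_isHomogeneous`).
[cite: Wlodarczyk2022, 2.1.10] -/
theorem exists_isAdmissibleCentre_support_subset_of_good [Smooth f] [NoetherianSpace Y] (Z : Closeds Y)
    (hne : (Z : Set Y).Nonempty) (hsub : (Z : Set Y) ⊆ singImage X)
    (hhom : ∀ (j : ℕ) (W : Y.affineOpens) (𝒜 : (Fin j → ℤ) → AddSubgroup Γ(Y, W)) [GradedRing 𝒜],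
      (X.ideal W).IsHomogeneous 𝒜 → ((Scheme.IdealSheafData.vanishingIdeal Z).ideal W).IsHomogeneous 𝒜) :
    ∃ R : ReesAlgebraData Y, IsAdmissibleCentre f X R ∧ (R.support).Nonempty ∧ R.support ⊆ (Z : Set Y) := by
  haveI : IsLocallyNoetherian Y := LocallyOfFiniteType.isLocallyNoetherian f
  have hY : Scheme.IsRegular Y := Scheme.IsRegular.of_smooth f (Scheme.isRegular_Spec (.of k))
  induction Z using WellFoundedLT.induction with
  | ind Z ih =>
    set J := Scheme.IdealSheafData.vanishingIdeal Z with hJ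
    by_cases hreg : Scheme.IsRegular J.subscheme
    · -- the powers of `𝓘(Z)` are admissible with support `Z`
      obtain ⟨R, hR, hsupp, hpiece⟩ := exists_isRegularWeightedCentre_support_eq hY J hreg
      have hsuppZ : R.support = (Z : Set Y) := by
        rw [hsupp, hJ, Scheme.IdealSheafData.coe_support_vanishingIdeal]
      refine ⟨R, ⟨hR, hsuppZ ▸ hsub, fun j W 𝒜 _ _ hXW n => ?_⟩, hsuppZ ▸ hne, hsuppZ.le⟩
      rw [hpiece, Scheme.IdealSheafData.ideal_pow, Pi.pow_apply]
      exact isHomogeneous_pow (hhom j W 𝒜 hXW) n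
    · -- descend to the non-regular locus `Z'` of the reduced `V(𝓘(Z))`
      let Z' : Closeds Y := ⟨{y : Y | ∃ x : J.subscheme, J.subschemeι x = y ∧
          ¬ IsRegularLocalRing (J.subscheme.presheaf.stalk x)}, isClosed_singSet f J⟩
      have hJsupp : (J.support : Set Y) = Z := Scheme.IdealSheafData.coe_support_vanishingIdeal Z
      have hmemZ : ∀ x : J.subscheme, J.subschemeι x ∈ (Z : Set Y) := fun x => by
        have h : J.subschemeι x ∈ (J.support : Set Y) := by
          rw [← Scheme.IdealSheafData.range_subschemeι]; exact ⟨x, rfl⟩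
        rwa [hJsupp] at h
      have hZ'Z : (Z' : Set Y) ⊆ Z := by
        rintro _ ⟨x, rfl, -⟩
        exact hmemZ x
      -- `Z' ≠ Z`: the reduced `V(𝓘(Z))` has a regular point
      haveI : IsReduced J.subscheme := isReduced_subscheme_vanishingIdeal Z
      have hlt : Z' < Z := by
        refine lt_of_le_of_ne hZ'Z fun heq => ?_
        obtain ⟨y, hy⟩ := hne
        have hy' : y ∈ (J.support : Set Y) := by rw [hJsupp]; exact hy
        rw [← Scheme.IdealSheafData.range_subschemeι] at hy'
        obtain ⟨x₀, -⟩ := hy'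
        haveI : Nonempty J.subscheme := ⟨x₀⟩
        obtain ⟨x, hx⟩ := (Scheme.dense_regularLocus (J.subscheme : Scheme.{0})).nonempty
        have hxZ' : J.subschemeι x ∈ (Z' : Set Y) := by rw [heq]; exact hmemZ x
        obtain ⟨x', hx', hnot⟩ := hxZ'
        have hxx : x' = x := J.subschemeι.isClosedEmbedding.injective hx'
        subst hxx
        exact hnot hx
      -- `Z'` is non-empty, inside `singImage X`, torus-intrinsic
      have hne' : (Z' : Set Y).Nonempty := by
        obtain ⟨x, hx⟩ : ∃ x : J.subscheme, ¬ IsRegularLocalRing (J.subscheme.presheaf.stalk x) := by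
          by_contra h
          push Not at h
          exact hreg h
        exact ⟨J.subschemeι x, x, rfl, hx⟩
      have hhom' : ∀ (j : ℕ) (W : Y.affineOpens) (𝒜 : (Fin j → ℤ) → AddSubgroup Γ(Y, W)) [GradedRing 𝒜],
          (X.ideal W).IsHomogeneous 𝒜 →
            ((Scheme.IdealSheafData.vanishingIdeal Z').ideal W).IsHomogeneous 𝒜 :=
        fun j W 𝒜 _ hXW => vanishingIdeal_singSet_isHomogeneous f J Z' rfl W 𝒜 (hhom j W 𝒜 hXW)
      obtain ⟨R, hadm, hRne, hRsub⟩ := ih Z' hlt hne' (hZ'Z.trans hsub) hhom'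
      exact ⟨R, hadm, hRne, hRsub.trans hZ'Z⟩

end Induction

/-! ## The theorem -/

/-- **Every singular pair admits an admissible centre with non-empty support.** Let `f : Y → Spec k` be smooth
and quasi-compact over a field and `X` an ideal sheaf on `Y` whose closed subscheme `V(X)` is NOT regular. Then
there is a Rees algebra `R` on `Y` with `IsAdmissibleCentre f X R` — `(iii-a)` a regular weighted centre,
`(iii-b′)` support inside `singImage X`, `(hom)` homogeneous on every torus chart of the pair — and NON-EMPTY
support: the powers of the reduced ideal of the last non-empty iterated singular stratum
`Sing(⋯Sing(Sing V(X))⋯)` (`exists_isAdmissibleCentre_support_subset_of_good` started at `Z₀ = singImage X`,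
which is closed (`isClosed_singSet`) and torus-intrinsic (`vanishingIdeal_singSet_isHomogeneous`)). So the
first step of an admissible sequence (`HypersurfacePair.AdmissiblyResolvable`) always exists non-trivially; the
door's content is termination alone. [cite: Wlodarczyk2022, 2.1.10 and Thm. 1.1.4 (6)] -/
theorem exists_isAdmissibleCentre {k : Type} [Field k] {Y : Scheme.{0}} (f : Y ⟶ Spec (.of k))
    [Smooth f] [QuasiCompact f] (X : Y.IdealSheafData) (hX : ¬ Scheme.IsRegular X.subscheme) :
    ∃ R : ReesAlgebraData Y, IsAdmissibleCentre f X R ∧ (R.support).Nonempty := by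
  haveI : IsLocallyNoetherian Y := LocallyOfFiniteType.isLocallyNoetherian f
  haveI : CompactSpace Y := QuasiCompact.compactSpace_of_compactSpace f
  haveI : IsNoetherian Y := {}
  let Z₀ : Closeds Y := ⟨singImage X, isClosed_singSet f X⟩
  have hne : (Z₀ : Set Y).Nonempty := by
    obtain ⟨x, hx⟩ : ∃ x : X.subscheme, ¬ IsRegularLocalRing (X.subscheme.presheaf.stalk x) := by
      by_contra h
      push Not at h
      exact hX h
    exact ⟨X.subschemeι x, x, rfl, hx⟩
  obtain ⟨R, hadm, hRne, -⟩ := exists_isAdmissibleCentre_support_subset_of_good f X Z₀ hne le_rfl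
    (fun j W 𝒜 _ hXW => vanishingIdeal_singSet_isHomogeneous f X Z₀ rfl W 𝒜 hXW)
  exact ⟨R, hadm, hRne⟩

/-- **Hypersurface-pair form**: at every SINGULAR hypersurface pair `P` over a field (`V(P.X)` not regular)
there is an admissible centre with non-empty support. [cite: Wlodarczyk2022, 2.1.10] -/
theorem HypersurfacePair.exists_isAdmissibleCentre {k : Type} [Field k] (P : HypersurfacePair k)
    (hP : ¬ Scheme.IsRegular P.X.subscheme) :
    ∃ R : ReesAlgebraData P.Y, IsAdmissibleCentre P.f P.X R ∧ (R.support).Nonempty :=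
  Theorems.exists_isAdmissibleCentre P.f P.X hP

end Summit.ResolutionOfSingularities.ResolutionOfSingularities.Theorems

end
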